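import Literature.NumberTheory.EllipticCurves.FormalExpTaylorUniformizationProofs
import Literature.NumberTheory.EllipticCurves.FormalGroupTranslationLaurentProofs
import Literature.NumberTheory.EllipticCurves.ComplexTorusAddProofs
import HarnessLib

/-!
# The Taylor series of `x(ξ(Ω + z)) = ℘(Ω + z) − b₂/12` at `z = 0` IS the translation series `translateX` read in the
# logarithmic coordinate: `𝓣[℘(Ω + ·) − b₂/12] = translateX(x₀, y₀) ∘ exp_W` (de Shalit II.4.9: «z = λ_Ê(t)»; proofs only)

Topic `NumberTheory/EllipticCurves` (theorems only; no definition, no named fact, no instance).  For a Weierstrass model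
`W/ℂ`, a period pair `L` of Néron type for it (`g₂ = c₄/12`, `g₃ = c₆/216`, uniformisation
`ξ(z) = (℘(z) − b₂/12, (℘'(z) − a₁x − a₃)/2)`, Silverman AEC VI.3.6) and `Ω ∉ Λ` with `P₀ = ξ(Ω) = (x₀, y₀)`:
* `taylor_localParamW_eq` — `𝓣[𝔴] = formalW ∘ exp_W` for `𝔴 = −1/y` (companion of the tree's `𝓣[𝔱] = exp_W`,
  `taylor_localParam_eq_formalExp`);
* `eventually_weierstrassP_add_mul_eq` — the chord formula `x(Ω + v)(x₀ − x(v))² = (y₀ − y(v))² + a₁(y₀ − y(v))(x₀ − x(v)) −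
  (a₂ + x₀ + x(v))(x₀ − x(v))²` on a punctured neighbourhood of `v = 0` (the uniformisation is a HOMOMORPHISM,
  `PeriodPair.exists_addMonoidHom_of_g₂_g₃'`, + Mathlib's chord law);
* ★★ `taylor_weierstrassP_add_sub_eq_translateX_subst_formalExp` — **`𝓣[v ↦ ℘(Ω + v) − b₂/12] =
  (W.translateX x₀ y₀).subst W.formalExp`**: de Shalit's «as local parameters at the origin, `z` and `t` are related via
  `z = λ_Ê(t)` … thus `Q(T) = P(λ_Ê(T))` is nothing but the expansion of [the function] in terms of `t` at `0`» (II.4.9, proof),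
  for the coordinate function `x(P₀ + ·)`: the ANALYTIC Taylor series in `z` equals the ALGEBRAIC `t`-expansion
  (`FormalGroupTranslation`) composed with `t = exp_W(z)`.  Proof: both satisfy the chart identity
  `Y·(x₀w − t)²·w = w(y₀w + 1)² + a₁(y₀w + 1)(x₀w − t)w − ((a₂ + x₀)w + t)(x₀w − t)²` in the domain `ℂ⟦z⟧`
  (`translateX_mul_chart_identity` resp. `𝓣` of the pointwise identity), and `(x₀w − t)²w ≠ 0`.
Cell `bsd-print-cf2`, seat `bsd-line-cf2c-w4` g12 (B6 ingredient (ii-β-x)); no summit statement is proved.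

## References
* [deShalit1987] E. de Shalit, *Iwasawa theory of elliptic curves with complex multiplication* (1987), II §4.9 (proof of (i)).
* [SilvermanAEC2009] J. H. Silverman, *The Arithmetic of Elliptic Curves*, 2nd ed. (2009), III.2.3, IV.1, VI.3.6.
-/

noncomputable section

open PowerSeries Filter Set Literature.NumberTheory.Transcendental.AndreCriterion
open scoped Topology Nat Classical

/-- The Taylor series of `f : ℂ → ℂ` at `0` (local notation, as in `AndreCriterionAnalyticProofs`). -/
local notation3 "𝓣[" f "]" =>
  (PowerSeries.mk fun n => ((Nat.factorial n : ℂ)⁻¹ * iteratedDeriv n f 0) : PowerSeries ℂ)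

namespace WeierstrassCurve

open PeriodPair Literature.NumberTheory.EllipticCurves

variable (L : PeriodPair) (W : WeierstrassCurve ℂ)

/-! ### `𝓣[𝔴] = formalW ∘ exp_W` -/

/-- **`𝓣[𝔴] = w(exp_W)`** for `𝔴 = −1/y` along the uniformisation: `𝓣[𝔴]` solves the fixed-point equation
`w = t³ + a₁tw + a₂t²w + a₃w² + a₄tw² + a₆w³` with `t = 𝓣[𝔱] = exp_W` (the Weierstrass equation divided by `y³`), whose
solution is unique (`fixedPoint_unique`). [cite: SilvermanAEC2009, IV.1.1] -/
theorem taylor_localParamW_eq (h₂ : L.g₂ = W.c₄ / 12) (h₃ : L.g₃ = W.c₆ / 216) :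
    𝓣[(fun z => if z ∈ L.lattice then (0 : ℂ) else
        -1 / ((℘'[L] z - W.a₁ * (℘[L] z - W.b₂ / 12) - W.a₃) / 2))] = W.formalW.subst W.formalExp := by
  obtain ⟨hta, hwa⟩ := analyticAt_localParam L W
  have hy := eventually_y_ne_zero L W
  set x : ℂ → ℂ := fun z => ℘[L] z - W.b₂ / 12 with hx
  set y : ℂ → ℂ := fun z => (℘'[L] z - W.a₁ * (℘[L] z - W.b₂ / 12) - W.a₃) / 2 with hydef
  set t : ℂ → ℂ := fun z => if z ∈ L.lattice then (0 : ℂ) else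
    -(℘[L] z - W.b₂ / 12) / ((℘'[L] z - W.a₁ * (℘[L] z - W.b₂ / 12) - W.a₃) / 2) with ht
  set w : ℂ → ℂ := fun z => if z ∈ L.lattice then (0 : ℂ) else
    -1 / ((℘'[L] z - W.a₁ * (℘[L] z - W.b₂ / 12) - W.a₃) / 2) with hw
  have ht0 : t 0 = 0 := by rw [ht]; exact if_pos (zero_mem _)
  have hw0 : w 0 = 0 := by rw [hw]; exact if_pos (zero_mem _)
  have hΛ := L.eventually_nhdsNE_notMem_lattice
  have htz : ∀ z, z ∉ L.lattice → t z = -x z / y z := fun z hz => by rw [ht]; exact if_neg hz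
  have hwz : ∀ z, z ∉ L.lattice → w z = -1 / y z := fun z hz => by rw [hw]; exact if_neg hz
  -- (E1): the Weierstrass equation divided by `y³`
  have hE1 : w =ᶠ[𝓝 0] fun z => t z ^ 3 + W.a₁ * (t * w) z + W.a₂ * (t ^ 2 * w) z +
      W.a₃ * (w ^ 2) z + W.a₄ * (t * w ^ 2) z + W.a₆ * (w ^ 3) z := by
    refine eventually_nhds_of_nhdsNE ?_ (by simp [ht0, hw0])
    filter_upwards [hΛ, hy] with z hzΛ hyz
    simp only [Pi.mul_apply, Pi.pow_apply]
    rw [htz z hzΛ, hwz z hzΛ]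
    have heq := equation_weierstrassP_sub L W h₂ h₃ hzΛ
    change y z ^ 2 + W.a₁ * x z * y z + W.a₃ * y z = x z ^ 3 + W.a₂ * x z ^ 2 + W.a₄ * x z + W.a₆
      at heq
    have key : -1 / y z - ((-x z / y z) ^ 3 + W.a₁ * (-x z / y z * (-1 / y z)) +
        W.a₂ * ((-x z / y z) ^ 2 * (-1 / y z)) + W.a₃ * (-1 / y z) ^ 2 +
        W.a₄ * (-x z / y z * (-1 / y z) ^ 2) + W.a₆ * (-1 / y z) ^ 3) =
        (-1 / y z ^ 3) * ((y z ^ 2 + W.a₁ * x z * y z + W.a₃ * y z) -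
          (x z ^ 3 + W.a₂ * x z ^ 2 + W.a₄ * x z + W.a₆)) := by
      field_simp
      ring
    rw [heq, sub_self, mul_zero, sub_eq_zero] at key
    exact key
  have hT0 : constantCoeff 𝓣[t] = 0 := by rw [constantCoeff_taylor, ht0]
  have hY0 : constantCoeff 𝓣[w] = 0 := by rw [constantCoeff_taylor, hw0]
  have hfun1 : (fun z => t z ^ 3 + W.a₁ * (t * w) z + W.a₂ * (t ^ 2 * w) z +
      W.a₃ * (w ^ 2) z + W.a₄ * (t * w ^ 2) z + W.a₆ * (w ^ 3) z) =
      t ^ 3 + (fun z => W.a₁ * (t * w) z) + (fun z => W.a₂ * (t ^ 2 * w) z) +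
        (fun z => W.a₃ * (w ^ 2) z) + (fun z => W.a₄ * (t * w ^ 2) z) +
        (fun z => W.a₆ * (w ^ 3) z) := by
    funext z
    simp only [Pi.add_apply, Pi.pow_apply]
  have h1 : AnalyticAt ℂ (t ^ 3) 0 := hta.pow 3
  have h2 : AnalyticAt ℂ (fun z => W.a₁ * (t * w) z) 0 := analyticAt_const.fun_mul (hta.mul hwa)
  have h3 : AnalyticAt ℂ (fun z => W.a₂ * (t ^ 2 * w) z) 0 :=
    analyticAt_const.fun_mul ((hta.pow 2).mul hwa)
  have h4 : AnalyticAt ℂ (fun z => W.a₃ * (w ^ 2) z) 0 := analyticAt_const.fun_mul (hwa.pow 2)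
  have h5 : AnalyticAt ℂ (fun z => W.a₄ * (t * w ^ 2) z) 0 :=
    analyticAt_const.fun_mul (hta.mul (hwa.pow 2))
  have h6 : AnalyticAt ℂ (fun z => W.a₆ * (w ^ 3) z) 0 := analyticAt_const.fun_mul (hwa.pow 3)
  have hF1 : 𝓣[w] = 𝓣[t] ^ 3 + C W.a₁ * 𝓣[t] * 𝓣[w] + C W.a₂ * 𝓣[t] ^ 2 * 𝓣[w] +
      C W.a₃ * 𝓣[w] ^ 2 + C W.a₄ * 𝓣[t] * 𝓣[w] ^ 2 + C W.a₆ * 𝓣[w] ^ 3 := by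
    have h := taylor_congr hE1
    rw [hfun1,
      taylor_add ((((h1.add h2).add h3).add h4).add h5) h6,
      taylor_add (((h1.add h2).add h3).add h4) h5, taylor_add ((h1.add h2).add h3) h4,
      taylor_add (h1.add h2) h3, taylor_add h1 h2, taylor_pow hta 3,
      taylor_const_mul, taylor_mul hta hwa, taylor_const_mul, taylor_mul (hta.pow 2) hwa,
      taylor_pow hta 2, taylor_const_mul, taylor_pow hwa 2, taylor_const_mul,
      taylor_mul hta (hwa.pow 2), taylor_pow hwa 2, taylor_const_mul, taylor_pow hwa 3] at h
    refine h.trans ?_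
    ring
  -- uniqueness of the fixed point, and `𝓣[t] = exp_W`
  have hfix := W.fixedPoint_unique hT0 hY0 (PowerSeries.constantCoeff_subst_eq_zero hT0 _ W.constantCoeff_formalW) hF1
    (W.formalW_subst_eq_step hT0)
  rw [taylor_localParam_eq_formalExp L W h₂ h₃] at hfix
  exact hfix

/-! ### The chord formula along the uniformisation -/

/-- `x(z) = ℘(z) − b₂/12` is not eventually equal to a constant near `0`: `℘ = 1/z² + (analytic)`.
[cite: SilvermanAEC2009, VI.3.6] -/
theorem eventually_weierstrassP_sub_ne (c : ℂ) : ∀ᶠ z in 𝓝[≠] (0 : ℂ), ℘[L] z - W.b₂ / 12 ≠ c := by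
  set E := ℘[L - (0 : ℂ)] with hE
  have hEa : AnalyticAt ℂ E 0 := L.analyticAt_weierstrassPExcept 0
  have hga : ContinuousAt (fun z : ℂ => z ^ 2 * (c + W.b₂ / 12 - E z)) 0 := by
    have : AnalyticAt ℂ (fun z : ℂ => z ^ 2 * (c + W.b₂ / 12 - E z)) 0 := by fun_prop
    exact this.continuousAt
  have hg0 : (fun z : ℂ => z ^ 2 * (c + W.b₂ / 12 - E z)) 0 ≠ 1 := by simp
  have hne := hga.eventually_ne hg0
  have hP : ∀ z, ℘[L] z = E z + 1 / z ^ 2 := L.weierstrassP_eq_weierstrassPExcept_add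
  filter_upwards [mem_nhdsWithin_of_mem_nhds hne, self_mem_nhdsWithin] with z hz hz0
  rw [mem_compl_iff, mem_singleton_iff] at hz0
  intro h
  apply hz
  rw [hP] at h
  have hz2 : z ^ 2 ≠ 0 := pow_ne_zero 2 hz0
  field_simp at h
  linear_combination (-1 / 12 : ℂ) * h

/-- **The chord formula along the uniformisation**: for `Ω ∉ Λ`, on a punctured neighbourhood of `v = 0`,
`x(Ω + v)·(x₀ − x(v))² = (y₀ − y(v))² + a₁(y₀ − y(v))(x₀ − x(v)) − (a₂ + x₀ + x(v))(x₀ − x(v))²`, `(x₀, y₀) = ξ(Ω)` — the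
uniformisation `ξ` is a homomorphism (`PeriodPair.exists_addMonoidHom_of_g₂_g₃'`) and Mathlib's chord law cleared of its
denominator (`chord_addX_mul`). [cite: SilvermanAEC2009, VI.3.6, III.2.3] -/
theorem eventually_weierstrassP_add_mul_eq (h₂ : L.g₂ = W.c₄ / 12) (h₃ : L.g₃ = W.c₆ / 216) {Ω : ℂ} (hΩ : Ω ∉ L.lattice) :
    ∀ᶠ v in 𝓝[≠] (0 : ℂ),
      (℘[L] (Ω + v) - W.b₂ / 12) * ((℘[L] Ω - W.b₂ / 12) - (℘[L] v - W.b₂ / 12)) ^ 2 =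
        ((℘'[L] Ω - W.a₁ * (℘[L] Ω - W.b₂ / 12) - W.a₃) / 2 - (℘'[L] v - W.a₁ * (℘[L] v - W.b₂ / 12) - W.a₃) / 2) ^ 2 +
          W.a₁ * ((℘'[L] Ω - W.a₁ * (℘[L] Ω - W.b₂ / 12) - W.a₃) / 2 -
            (℘'[L] v - W.a₁ * (℘[L] v - W.b₂ / 12) - W.a₃) / 2) * ((℘[L] Ω - W.b₂ / 12) - (℘[L] v - W.b₂ / 12)) -
          (W.a₂ + (℘[L] Ω - W.b₂ / 12) + (℘[L] v - W.b₂ / 12)) * ((℘[L] Ω - W.b₂ / 12) - (℘[L] v - W.b₂ / 12)) ^ 2 := by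
  obtain ⟨u, -, -, hu⟩ := PeriodPair.exists_addMonoidHom_of_g₂_g₃' (L := L) h₂ h₃
  have hΛ := L.eventually_nhdsNE_notMem_lattice
  have hne := eventually_weierstrassP_sub_ne L W (℘[L] Ω - W.b₂ / 12)
  -- `Ω + v ∉ Λ` near `v = 0`
  have hΩv : ∀ᶠ v in 𝓝 (0 : ℂ), Ω + v ∉ L.lattice := by
    have hopen : IsOpen ((L.lattice : Set ℂ)ᶜ) := L.isClosed_lattice.isOpen_compl
    have hcont : Continuous fun v : ℂ => Ω + v := continuous_const.add continuous_id
    have : (fun v : ℂ => Ω + v) ⁻¹' (L.lattice : Set ℂ)ᶜ ∈ 𝓝 (0 : ℂ) :=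
      hcont.continuousAt.preimage_mem_nhds (hopen.mem_nhds (by simpa using hΩ))
    filter_upwards [this] with v hv
    exact hv
  filter_upwards [hΛ, hne, mem_nhdsWithin_of_mem_nhds hΩv] with v hvΛ hvne hΩvΛ
  obtain ⟨hΩ', huΩ⟩ := hu Ω hΩ
  obtain ⟨hv', huv⟩ := hu v hvΛ
  obtain ⟨hΩv', huΩv⟩ := hu (Ω + v) hΩvΛ
  have hadd := u.map_add Ω v
  rw [huΩv, huΩ, huv, Affine.Point.add_of_X_ne (Ne.symm hvne)] at hadd
  have hx3 := (Affine.Point.some.injEq _ _ _ _ _ _).mp hadd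
  rw [hx3.1]
  exact chord_addX_mul W _ _ (Ne.symm hvne)


/-! ### The Taylor series of `x(ξ(Ω + ·))` is `translateX ∘ exp_W` -/

omit L in
/-- `[z¹] f(g) = [z¹]f · [z¹]g` for `g(0) = 0`. [folklore] -/
private theorem coeff_one_subst_eq_mul' (f : ℂ⟦X⟧) {g : ℂ⟦X⟧} (hg : constantCoeff g = 0) :
    coeff 1 (f.subst g) = coeff 1 f * coeff 1 g := by
  rw [coeff_subst' (HasSubst.of_constantCoeff_zero' hg), finsum_eq_single _ 1]
  · rw [pow_one, smul_eq_mul]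
  · intro d hd
    rcases Nat.lt_or_gt_of_ne hd with h0 | h2
    · rw [Nat.lt_one_iff.mp h0, pow_zero, coeff_one, if_neg one_ne_zero, smul_zero]
    · rw [X_pow_dvd_iff.mp (pow_dvd_pow_of_dvd (X_dvd_iff.mpr hg) d) 1 h2, smul_zero]

omit L in
/-- `w(exp_W)·X(exp_W) = exp_W³` (`w·X = z³`) — so `w(exp_W) ≠ 0`. [cite: SilvermanAEC2009, IV.1.1] -/
private theorem formalW_subst_formalExp_ne_zero : W.formalW.subst W.formalExp ≠ 0 := by
  have hs : HasSubst W.formalExp := HasSubst.of_constantCoeff_zero' W.constantCoeff_formalExp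
  have h1 : coeff 1 W.formalExp = 1 := by
    have h := congrArg (coeff 1) W.formalExp_subst_formalLog
    rwa [coeff_one_subst_eq_mul' _ W.constantCoeff_formalLog, coeff_one_formalLog, mul_one, coeff_one_X] at h
  have hexp0 : W.formalExp ≠ 0 := fun h => by simp [h] at h1
  have hXw : W.formalW * W.formalXMulSq = X ^ 3 := by
    rw [W.formalW_eq_X_pow_mul_formalWDivCube, mul_assoc, W.formalWDivCube_mul_formalXMulSq, mul_one]
  have h := congrArg (PowerSeries.subst W.formalExp) hXw
  rw [subst_mul hs, subst_pow hs, subst_X hs] at h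
  intro h0
  rw [h0, zero_mul] at h
  exact pow_ne_zero 3 hexp0 h.symm

/-- ★★ **`𝓣[v ↦ ℘(Ω + v) − b₂/12] = translateX(x₀, y₀) ∘ exp_W`** for `Ω ∉ Λ`, `(x₀, y₀) = ξ(Ω)`: the Taylor series at `0`
of the `x`-coordinate of `ξ(Ω + v) = P₀ + ξ(v)` IS the algebraic `t`-expansion of `x(P₀ + P(t))` (`FormalGroupTranslation`)
in the logarithmic coordinate `t = exp_W(z)` — de Shalit's «`z = λ_Ê(t)` … `Q(T) = P(λ_Ê(T))` is nothing but the expansion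
in terms of `t` at `0`», for the coordinate function. [cite: deShalit1987, II §4.9 (proof of (i))] [cite: SilvermanAEC2009, IV.1, VI.3.6] -/
theorem taylor_weierstrassP_add_sub_eq_translateX_subst_formalExp (h₂ : L.g₂ = W.c₄ / 12) (h₃ : L.g₃ = W.c₆ / 216)
    {Ω : ℂ} (hΩ : Ω ∉ L.lattice) :
    𝓣[fun v => ℘[L] (Ω + v) - W.b₂ / 12] =
      (W.translateX (℘[L] Ω - W.b₂ / 12) ((℘'[L] Ω - W.a₁ * (℘[L] Ω - W.b₂ / 12) - W.a₃) / 2)).subst W.formalExp := by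
  obtain ⟨hta, hwa⟩ := analyticAt_localParam L W
  have hy := eventually_y_ne_zero L W
  have hΛ := L.eventually_nhdsNE_notMem_lattice
  have hTt := taylor_localParam_eq_formalExp L W h₂ h₃
  have hTw := taylor_localParamW_eq L W h₂ h₃
  have hchord := eventually_weierstrassP_add_mul_eq L W h₂ h₃ hΩ
  set x₀ : ℂ := ℘[L] Ω - W.b₂ / 12 with hx₀
  set y₀ : ℂ := (℘'[L] Ω - W.a₁ * (℘[L] Ω - W.b₂ / 12) - W.a₃) / 2 with hy₀
  set x : ℂ → ℂ := fun z => ℘[L] z - W.b₂ / 12 with hx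
  set y : ℂ → ℂ := fun z => (℘'[L] z - W.a₁ * (℘[L] z - W.b₂ / 12) - W.a₃) / 2 with hydef
  set t : ℂ → ℂ := fun z => if z ∈ L.lattice then (0 : ℂ) else
    -(℘[L] z - W.b₂ / 12) / ((℘'[L] z - W.a₁ * (℘[L] z - W.b₂ / 12) - W.a₃) / 2) with ht
  set w : ℂ → ℂ := fun z => if z ∈ L.lattice then (0 : ℂ) else
    -1 / ((℘'[L] z - W.a₁ * (℘[L] z - W.b₂ / 12) - W.a₃) / 2) with hw
  set F : ℂ → ℂ := fun v => ℘[L] (Ω + v) - W.b₂ / 12 with hF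
  have htz : ∀ z, z ∉ L.lattice → t z = -x z / y z := fun z hz => by rw [ht]; exact if_neg hz
  have hwz : ∀ z, z ∉ L.lattice → w z = -1 / y z := fun z hz => by rw [hw]; exact if_neg hz
  -- `F` is analytic at `0`
  have hFa : AnalyticAt ℂ F 0 := by
    have hopen : (L.lattice : Set ℂ)ᶜ ∈ 𝓝 ((fun v : ℂ => Ω + v) 0) := by
      simpa using L.isClosed_lattice.isOpen_compl.mem_nhds hΩ
    have hPa : AnalyticAt ℂ ℘[L] ((fun v : ℂ => Ω + v) 0) := L.differentiableOn_weierstrassP.analyticAt hopen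
    exact (hPa.comp (analyticAt_const.add analyticAt_id)).sub analyticAt_const
  -- the constants as functions
  set cx : ℂ → ℂ := fun _ => x₀ with hcx
  set cy : ℂ → ℂ := fun _ => y₀ with hcy
  set c1 : ℂ → ℂ := fun _ => W.a₁ with hc1
  set c2 : ℂ → ℂ := fun _ => W.a₂ + x₀ with hc2
  have hcxa : AnalyticAt ℂ cx 0 := analyticAt_const
  have hcya : AnalyticAt ℂ cy 0 := analyticAt_const
  have hc1a : AnalyticAt ℂ c1 0 := analyticAt_const
  have hc2a : AnalyticAt ℂ c2 0 := analyticAt_const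
  have h1a : AnalyticAt ℂ (1 : ℂ → ℂ) 0 := analyticAt_const
  have hA : AnalyticAt ℂ (cy * w + 1) 0 := (hcya.mul hwa).add h1a
  have hB : AnalyticAt ℂ (cx * w - t) 0 := (hcxa.mul hwa).sub hta
  have hC : AnalyticAt ℂ (c2 * w + t) 0 := (hc2a.mul hwa).add hta
  -- the chord formula times `w³`, pointwise on a punctured neighbourhood, then as analytic germs
  have hLR : (F * (cx * w - t) ^ 2 * w) =ᶠ[𝓝 0]
      (w * (cy * w + 1) ^ 2 + c1 * (cy * w + 1) * (cx * w - t) * w - (c2 * w + t) * (cx * w - t) ^ 2) := by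
    have hL : AnalyticAt ℂ (F * (cx * w - t) ^ 2 * w) 0 := (hFa.mul (hB.pow 2)).mul hwa
    have hR : AnalyticAt ℂ (w * (cy * w + 1) ^ 2 + c1 * (cy * w + 1) * (cx * w - t) * w -
        (c2 * w + t) * (cx * w - t) ^ 2) 0 :=
      ((hwa.mul (hA.pow 2)).add (((hc1a.mul hA).mul hB).mul hwa)).sub (hC.mul (hB.pow 2))
    refine (hL.frequently_eq_iff_eventually_eq hR).mp (Filter.Eventually.frequently ?_)
    filter_upwards [hchord, hΛ, hy] with v hv hvΛ hyv
    simp only [Pi.mul_apply, Pi.sub_apply, Pi.add_apply, Pi.pow_apply, Pi.one_apply, hcx, hcy, hc1, hc2]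
    rw [htz v hvΛ, hwz v hvΛ]
    have hyv' : y v ≠ 0 := hyv
    have key : F v * (x₀ * (-1 / y v) - -x v / y v) ^ 2 * (-1 / y v) -
        (-1 / y v * (y₀ * (-1 / y v) + 1) ^ 2 + W.a₁ * (y₀ * (-1 / y v) + 1) * (x₀ * (-1 / y v) - -x v / y v) * (-1 / y v) -
          ((W.a₂ + x₀) * (-1 / y v) + -x v / y v) * (x₀ * (-1 / y v) - -x v / y v) ^ 2) =
        (-1 / y v ^ 3) * (F v * (x₀ - x v) ^ 2 -
          ((y₀ - y v) ^ 2 + W.a₁ * (y₀ - y v) * (x₀ - x v) - (W.a₂ + x₀ + x v) * (x₀ - x v) ^ 2)) := by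
      field_simp
      ring
    rw [← sub_eq_zero, key, hv, sub_self, mul_zero]
  -- Taylor series of both sides
  have hT := taylor_congr hLR
  rw [taylor_mul (hFa.mul (hB.pow 2)) hwa, taylor_mul hFa (hB.pow 2), taylor_pow hB, taylor_sub (hcxa.mul hwa) hta,
    taylor_mul hcxa hwa, taylor_sub ((hwa.mul (hA.pow 2)).add (((hc1a.mul hA).mul hB).mul hwa)) (hC.mul (hB.pow 2)),
    taylor_add (hwa.mul (hA.pow 2)) (((hc1a.mul hA).mul hB).mul hwa), taylor_mul hwa (hA.pow 2), taylor_pow hA,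
    taylor_add (hcya.mul hwa) h1a, taylor_mul hcya hwa, taylor_one, taylor_mul ((hc1a.mul hA).mul hB) hwa,
    taylor_mul (hc1a.mul hA) hB, taylor_mul hc1a hA, taylor_add (hcya.mul hwa) h1a, taylor_mul hcya hwa,
    taylor_sub (hcxa.mul hwa) hta, taylor_mul hcxa hwa, taylor_mul hC (hB.pow 2), taylor_add (hc2a.mul hwa) hta,
    taylor_mul hc2a hwa, taylor_pow hB, taylor_sub (hcxa.mul hwa) hta, taylor_mul hcxa hwa, hcx, hcy, hc1, hc2,
    taylor_const, taylor_const, taylor_const, taylor_const, taylor_one, hTt, hTw, map_add] at hT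
  -- the algebraic series satisfies the same identity
  have hs : HasSubst W.formalExp := HasSubst.of_constantCoeff_zero' W.constantCoeff_formalExp
  have halg := congrArg (PowerSeries.subst W.formalExp) (W.translateX_mul_chart_identity x₀ y₀)
  simp only [← coe_substAlgHom hs, map_mul, map_sub, map_add, map_pow, map_one,
    Literature.NumberTheory.EllipticCurves.substAlgHom_C, substAlgHom_X] at halg
  simp only [coe_substAlgHom hs] at halg
  -- cancel the non-zero factor `(x₀·w(exp) − exp)²·w(exp)`
  have hB0 : C x₀ * W.formalW.subst W.formalExp - W.formalExp ≠ 0 := by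
    intro h0
    have h1 := congrArg (coeff 1) h0
    have hexp1 : coeff 1 W.formalExp = 1 := by
      have h := congrArg (coeff 1) W.formalExp_subst_formalLog
      rwa [coeff_one_subst_eq_mul' _ W.constantCoeff_formalLog, coeff_one_formalLog, mul_one, coeff_one_X] at h
    rw [map_sub, coeff_C_mul, coeff_one_subst_eq_mul' _ W.constantCoeff_formalExp, W.coeff_formalW_of_lt_three (by norm_num),
      zero_mul, mul_zero, zero_sub, hexp1, map_zero, neg_eq_zero] at h1
    exact one_ne_zero h1
  have hA0 : (C x₀ * W.formalW.subst W.formalExp - W.formalExp) ^ 2 * W.formalW.subst W.formalExp ≠ 0 :=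
    mul_ne_zero (pow_ne_zero 2 hB0) (formalW_subst_formalExp_ne_zero W)
  refine mul_right_cancel₀ hA0 ?_
  rw [← mul_assoc, ← mul_assoc, hT, ← halg]

end WeierstrassCurve
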